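import Mathlib
import Summits.QuantumFields.YangMills.Theses.MagneticFluxCeiling

/-!
# `MagneticFluxCeiling.Assembly` — proof of the assembly item ⟨stmt-QuantumFields-25311⟩ of LINE g21-A (seat ym-idea-4)

`Assembly : PlaneIndependence → SpectralSandwich → CoulombCeiling → AspectOnePurity → FluxSectorAlternative.NoHiggsMode`.
Given the heavy branch `Z_z(n+2)/Z_1(n+2) → 0` for some plane `q`, plane independence moves it to the spatial plane
`q₀ = (0,1)`; at side `L = n + 2 ≥ L₀` the Coulomb ceiling supplies `(K, M₀)`, the spectral sandwich gives
`Z_z(L⁴)/Z_1(L⁴) ≥ e^{-C}·Z(L³×2L)/Z(L⁴)²` (anisotropic functions at equal sides are the symmetric ones,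
`twistedPartitionFunctionAniso_self`), aspect-one purity gives `≥ c·e^{-C} > 0`, contradicting `< c·e^{-C}` eventually.
No summit is proved here; this closes the assembly item only. [cite: tHooft1979Flux, §XI–XII] [cite: Greensite2011, §4.4]
-/

open Filter Topology

namespace Summit.QuantumFields.YangMills.Theorems.MagneticFluxCeiling

open Summit.QuantumFields.YangMills.Theses.MagneticFluxCeiling

open Literature.MathematicalPhysics.QuantumFieldTheory in
/-- ★ The assembly item of route `MagneticFluxCeiling`, kernel-checked. -/
theorem assembly_proof : Summit.QuantumFields.YangMills.Theses.MagneticFluxCeiling.Assembly := by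
  intro hP hS h1 h2 N hN r β hβ z hz hz1 q habs
  obtain ⟨C, L₀, hC⟩ := h1 N hN r β hβ z hz hz1
  obtain ⟨c, hc, L₀', hc'⟩ := h2 N hN r β hβ
  set q₀ : {p : Fin 4 × Fin 4 // p.1 < p.2} := ⟨((0 : Fin 4), (1 : Fin 4)), by decide⟩ with hq₀
  have hε : 0 < c * Real.exp (-C) := mul_pos hc (Real.exp_pos _)
  -- eventually the symmetric-torus ratio is below ε
  have hev := (habs.eventually (gt_mem_nhds hε))
  rw [Filter.eventually_atTop] at hev
  obtain ⟨n₁, hn₁⟩ := hev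
  set n : ℕ := max n₁ (max L₀ L₀') with hn
  have hn1 : n₁ ≤ n := le_max_left _ _
  have hnL : L₀ ≤ n + 2 := (le_max_left _ _).trans ((le_max_right _ _).trans (Nat.le_add_right _ _))
  have hnL' : L₀' ≤ n + 2 := (le_max_right _ _).trans ((le_max_right _ _).trans (Nat.le_add_right _ _))
  have hlt := hn₁ n hn1
  -- the ceiling datum at L = n + 2 and the sandwich
  obtain ⟨K, M₀, hM⟩ := hC (n + 2) hnL
  have hsand := hS N hN r β hβ z hz (n + 2) (by omega) C K M₀ hM
  -- purity
  have hpur := hc' (n + 2) hnL'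
  haveI : NeZero (n + 2) := ⟨by omega⟩
  have hZpos : 0 < wilsonFinTorusPartition r.ρ β (n + 2) (n + 2) (n + 2) (n + 2) := by
    have h := twistedPartitionFunctionAniso_pos r.ρ r.continuous β (n + 2) (n + 2) (1 : Matrix.specialUnitaryGroup (Fin N) ℂ) q₀
    rwa [twistedPartitionFunctionAniso_one] at h
  have hlow : c * Real.exp (-C) ≤ Real.exp (-C) * wilsonFinTorusPartition r.ρ β (n + 2) (n + 2) (n + 2) (2 * (n + 2)) /
      (wilsonFinTorusPartition r.ρ β (n + 2) (n + 2) (n + 2) (n + 2)) ^ 2 := by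
    rw [mul_comm c, mul_div_assoc]
    refine mul_le_mul_of_nonneg_left ?_ (Real.exp_pos _).le
    rw [le_div_iff₀ (pow_pos hZpos 2)]
    exact hpur
  -- identify the symmetric-torus ratio with the anisotropic one in the plane q₀
  have hplane_z : twistedPartitionFunction r.ρ β (n + 2) z q = twistedPartitionFunction r.ρ β (n + 2) z q₀ :=
    hP N r β z n q q₀
  have hplane_1 : twistedPartitionFunction r.ρ β (n + 2) 1 q = twistedPartitionFunction r.ρ β (n + 2) 1 q₀ :=
    hP N r β 1 n q q₀
  have hratio : twistedPartitionFunction r.ρ β (n + 2) z q / twistedPartitionFunction r.ρ β (n + 2) 1 q =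
      twistedPartitionFunctionAniso r.ρ β (n + 2) (n + 2) z q₀ / twistedPartitionFunctionAniso r.ρ β (n + 2) (n + 2) 1 q₀ := by
    rw [hplane_z, hplane_1, twistedPartitionFunctionAniso_self, twistedPartitionFunctionAniso_self]
  have hge : c * Real.exp (-C) ≤ twistedPartitionFunction r.ρ β (n + 2) z q / twistedPartitionFunction r.ρ β (n + 2) 1 q := by
    rw [hratio]; exact hlow.trans hsand
  exact absurd hlt (not_lt.2 hge)


end Summit.QuantumFields.YangMills.Theorems.MagneticFluxCeiling
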